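import Summits.QuantumFields.YangMills.Theorems.LocalInsertionHistoryTailOfInsertionLExponents
import Summits.QuantumFields.YangMills.Theorems.PoincareLipschitzTwoSidedOfConcentrationCounting
import HarnessLib

/-!
# The per-plaquette tail from the local insertion bound: Chernoff + finest bad level
# (helper for the glue `HistoryTailOfInsertionL`, stmt-QuantumFields-23608, route `LocalInsertion`, planner ym-r3-idea-2 g7 LINE 16)

Route-independent.  For ONE family `F`, ONE coupling `0 < γ ≤ 1` and a profile with `ε b₀ ≥ 8`, `b₀² ≥ 32`, `p₀ ≥ 2`, the LOCAL INSERTION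
BOUND (the `Gibbs_K`-integral over the local small-history event `G(a,j)` of `exp(ε·min(|Ū^{j}(∂a) − 1|/g_{K−j}, p(g_{K−j})))` is `≤ M₀`)
gives: §1 `chernoff_local` (`Gibbs_K(G(a,j) ∩ {θ(K−j) ≤ |Ū^{j}(∂a) − 1|}) ≤ M₀·e^{−ε p(g_{K−j})}`: on the large-field event the capped
flux equals its cap, `θ = g·p(g)`); §4 ★ `perPlaquette_of_localInsertion`
— FINEST BAD LEVEL, no recursion: `{large at (a,j)} ⊆ (G(a,j) ∩ large) ∪ G(a,j)ᶜ`, `G(a,j)ᶜ ⊆ ⋃_{i<j} ⋃_{q near a} (large at (q,i) ∩ G(q,i))`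
(width seat w3's `compl_localGood_subset`), each piece bounded by §1 (`i ≥ 1`) or the tree's bare per-plaquette bound
`gibbsMeasure_real_dist1_ge_le` (`i = 0`), local counts `card_near_le_real`, exponents from `…Exponents`:
`Gibbs_K{θ(K−j) ≤ |Ū^{j}(∂a) − 1|} ≤ (M₀(1 + 9·129³) + 9·129³·C_bare)·β_{K−j}⁵·e^{−8(1 + log g_{K−j}⁻¹)²}`.  [cite: Balaban1985UV3, (7), (71)]
HONEST FRAMING: `LocalInsertionL` (stmt-QuantumFields-23607) and 20520 / 19200 are OPEN; helper for a glue item; no rung (R3 RECORD), no summit,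
no mass gap proved.  Cell `ym-idea-1`, width seat `ym-line-sfw-p2-w5` g12 (R3 family; free hands).  THEOREMS ONLY, definition-free.
-/

set_option autoImplicit false

noncomputable section

open scoped BigOperators
open MeasureTheory Filter Topology
open Literature.MathematicalPhysics.QuantumFieldTheory.Balaban1983to89
open Literature.MathematicalPhysics.QuantumFieldTheory.Balaban1983to89.T3ContinuumYM3Torus
open Literature.MathematicalPhysics.QuantumFieldTheory.Balaban1983to89.T3UnitScaleTilt
open Literature.MathematicalPhysics.QuantumFieldTheory.Balaban1983to89.T3UnitLawDensityEML
open Literature.MathematicalPhysics.QuantumFieldTheory.Balaban1983to89.T3CruxEstimates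
open Literature.MathematicalPhysics.QuantumFieldTheory.Balaban1983to89.T3BareTailProfile
open Literature.MathematicalPhysics.QuantumFieldTheory.Balaban1983to89.T3AveragedTailProfile
open Literature.MathematicalPhysics.QuantumFieldTheory.Balaban1983to89.T3FinestHeightTail
open Summit.QuantumFields.YangMills.Theorems.PoincareLipschitz.TwoSidedOfConcentration
  (compl_localGood_subset card_near_le_real sum_Ico_inv_pow_le_one)
open Literature.MathematicalPhysics.QuantumFieldTheory.Balaban1983to89.T4Continuum (measurable_iter)
open Literature.MathematicalPhysics.QuantumFieldTheory.Balaban1983to89.Missing (measurable_plaqHol)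

namespace Summit.QuantumFields.YangMills.Theorems.LocalInsertion.HistoryTailOfInsertion

/-! ## §1 Measurability of the flux observables and of the local good sets; the Chernoff step -/

/-- The block-averaged flux `U ↦ |Ū^{i}(∂q) − 1|` of the `K`-th approximation is measurable. [cite: Balaban1985UV3, (7) p.257] -/
theorem measurable_flux (F : T3Family) (K i : ℕ) (q : Plaq (F.P K) i) :
    Measurable fun U : GaugeField (F.P K) 0 (Matrix.specialUnitaryGroup (Fin 2) ℂ) =>
      GaugeGroup.dist1 (GaugeField.plaqHol
        (Averaging.iter (fun i' => BlockAveraging.blockAvg (P := F.P K) (j := i') ℰp) i U) q) :=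
  RegularGaugeGroup.measurable_dist1.comp ((measurable_plaqHol q).comp (measurable_iter _ (measurable_blockAvg F K) i))

/-- The local good sets `G(a,j) = {∀ i < j, ∀ q near a, |Ū^{i}(∂q) − 1| < θ(K−i)}` are measurable (countably many measurable
conditions). [cite: Balaban1985UV3, (7) p.257] -/
theorem measurableSet_localGood (F : T3Family) (θ : ℕ → ℝ) (K j : ℕ) (near : (i : ℕ) → Plaq (F.P K) i → Prop) :
    MeasurableSet {U : GaugeField (F.P K) 0 (Matrix.specialUnitaryGroup (Fin 2) ℂ) |
      ∀ (i : ℕ) (q : Plaq (F.P K) i), i < j → near i q →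
        GaugeGroup.dist1 (GaugeField.plaqHol
          (Averaging.iter (fun i' => BlockAveraging.blockAvg (P := F.P K) (j := i') ℰp) i U) q) < θ i} := by
  classical
  have hset : {U : GaugeField (F.P K) 0 (Matrix.specialUnitaryGroup (Fin 2) ℂ) |
      ∀ (i : ℕ) (q : Plaq (F.P K) i), i < j → near i q →
        GaugeGroup.dist1 (GaugeField.plaqHol
          (Averaging.iter (fun i' => BlockAveraging.blockAvg (P := F.P K) (j := i') ℰp) i U) q) < θ i} =
      ⋂ i : ℕ, ⋂ q : Plaq (F.P K) i, {U | i < j → near i q →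
        GaugeGroup.dist1 (GaugeField.plaqHol
          (Averaging.iter (fun i' => BlockAveraging.blockAvg (P := F.P K) (j := i') ℰp) i U) q) < θ i} := by
    ext U; simp only [Set.mem_setOf_eq, Set.mem_iInter]
  rw [hset]
  refine MeasurableSet.iInter fun i => MeasurableSet.iInter fun q => ?_
  by_cases h : i < j ∧ near i q
  · have : {U : GaugeField (F.P K) 0 (Matrix.specialUnitaryGroup (Fin 2) ℂ) | i < j → near i q →
        GaugeGroup.dist1 (GaugeField.plaqHol
          (Averaging.iter (fun i' => BlockAveraging.blockAvg (P := F.P K) (j := i') ℰp) i U) q) < θ i} =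
        {U | GaugeGroup.dist1 (GaugeField.plaqHol
          (Averaging.iter (fun i' => BlockAveraging.blockAvg (P := F.P K) (j := i') ℰp) i U) q) < θ i} := by
      ext U; simp only [Set.mem_setOf_eq]; exact ⟨fun hU => hU h.1 h.2, fun hU _ _ => hU⟩
    rw [this]
    exact measurableSet_lt (measurable_flux F K i q) measurable_const
  · have : {U : GaugeField (F.P K) 0 (Matrix.specialUnitaryGroup (Fin 2) ℂ) | i < j → near i q →
        GaugeGroup.dist1 (GaugeField.plaqHol
          (Averaging.iter (fun i' => BlockAveraging.blockAvg (P := F.P K) (j := i') ℰp) i U) q) < θ i} = Set.univ := by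
      ext U; simp only [Set.mem_setOf_eq, Set.mem_univ, iff_true]; exact fun h1 h2 => (h ⟨h1, h2⟩).elim
    rw [this]; exact MeasurableSet.univ

/-- **THE CHERNOFF STEP.**  If the Gibbs integral over an event `G` of `exp(ε·min(|Ū^{j}(∂a) − 1|/g, p(g)))` (`g = g_{K−j}`) is
`≤ M₀`, then `Gibbs_K(G ∩ {θ(K−j) ≤ |Ū^{j}(∂a) − 1|}) ≤ M₀·e^{−ε p(g_{K−j})}`: on the large-field event the capped normalised flux
equals its cap (`θ = g·p(g)`). [cite: Balaban1985UV3, (7) p.257 and (71) p.273] -/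
theorem chernoff_local (F : T3Family) {γ b₀ p₀ ε M₀ : ℝ} (hγ : 0 < γ) (hε : 0 < ε) {K j : ℕ} (a : Plaq (F.P K) j)
    {G : Set (GaugeField (F.P K) 0 (Matrix.specialUnitaryGroup (Fin 2) ℂ))} (hG : MeasurableSet G)
    (hint : ∫ U in G, Real.exp (ε * min (GaugeGroup.dist1 (GaugeField.plaqHol
        (Averaging.iter (fun i' => BlockAveraging.blockAvg (P := F.P K) (j := i') ℰp) j U) a) /
          Real.sqrt (γ * ((F.L : ℝ)⁻¹) ^ (K - j)))
        (B10.pFun b₀ p₀ (Real.sqrt (γ * ((F.L : ℝ)⁻¹) ^ (K - j))))) ∂(gibbsK F ℰp γ K) ≤ M₀) :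
    (gibbsK F ℰp γ K).real ({U | θBal F.L γ b₀ p₀ (K - j) ≤ GaugeGroup.dist1 (GaugeField.plaqHol
        (Averaging.iter (fun i' => BlockAveraging.blockAvg (P := F.P K) (j := i') ℰp) j U) a)} ∩ G) ≤
      M₀ * Real.exp (-(ε * B10.pFun b₀ p₀ (Real.sqrt (γ * ((F.L : ℝ)⁻¹) ^ (K - j))))) := by
  haveI := isProbabilityMeasure_gibbsK F ℰp hγ.le K
  set μ := gibbsK F ℰp γ K with hμ
  set g : ℝ := Real.sqrt (γ * ((F.L : ℝ)⁻¹) ^ (K - j)) with hg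
  set P : ℝ := B10.pFun b₀ p₀ g with hP
  set f : GaugeField (F.P K) 0 (Matrix.specialUnitaryGroup (Fin 2) ℂ) → ℝ := fun U =>
    GaugeGroup.dist1 (GaugeField.plaqHol
      (Averaging.iter (fun i' => BlockAveraging.blockAvg (P := F.P K) (j := i') ℰp) j U) a) with hf
  have hfm : Measurable f := measurable_flux F K j a
  have hL0 : (0 : ℝ) < F.L := by exact_mod_cast lt_trans zero_lt_one F.hL.2
  have hgpos : 0 < g := Real.sqrt_pos.2 (mul_pos hγ (pow_pos (inv_pos.2 hL0) _))
  -- the integrand and its bound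
  set φ : GaugeField (F.P K) 0 (Matrix.specialUnitaryGroup (Fin 2) ℂ) → ℝ := fun U => Real.exp (ε * min (f U / g) P)
    with hφ
  have hφm : Measurable φ := Real.measurable_exp.comp (measurable_const.mul ((hfm.div_const g).min measurable_const))
  have hφle : ∀ U, φ U ≤ Real.exp (ε * P) := fun U =>
    Real.exp_le_exp.2 (mul_le_mul_of_nonneg_left (min_le_right _ _) hε.le)
  have hφ0 : ∀ U, 0 ≤ φ U := fun U => Real.exp_nonneg _
  have hφint : Integrable φ μ :=
    (integrable_const (Real.exp (ε * P))).mono' hφm.aestronglyMeasurable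
      (Filter.Eventually.of_forall fun U => by rw [Real.norm_eq_abs, abs_of_nonneg (hφ0 U)]; exact hφle U)
  -- the large-field event
  set B : Set (GaugeField (F.P K) 0 (Matrix.specialUnitaryGroup (Fin 2) ℂ)) := {U | θBal F.L γ b₀ p₀ (K - j) ≤ f U} with hB
  have hBm : MeasurableSet B := measurableSet_le measurable_const hfm
  have hθ : θBal F.L γ b₀ p₀ (K - j) = g * P := rfl
  have hφB : ∀ U ∈ B ∩ G, Real.exp (ε * P) ≤ φ U := by
    intro U hU
    have hU1 : g * P ≤ f U := by rw [← hθ]; exact hU.1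
    have hmin : min (f U / g) P = P := min_eq_right ((le_div_iff₀ hgpos).2 (by rw [mul_comm]; exact hU1))
    simp only [hφ, hmin]; exact le_rfl
  -- Chernoff
  have h1 : Real.exp (ε * P) * μ.real (B ∩ G) ≤ ∫ U in B ∩ G, φ U ∂μ := by
    have := setIntegral_ge_of_const_le (hBm.inter hG) (measure_ne_top μ _) hφB hφint.integrableOn
    simpa [Measure.real, mul_comm] using this
  have h2 : ∫ U in B ∩ G, φ U ∂μ ≤ ∫ U in G, φ U ∂μ :=
    setIntegral_mono_set hφint.integrableOn (Filter.Eventually.of_forall fun U => hφ0 U)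
      (Filter.Eventually.of_forall Set.inter_subset_right)
  have h3 : ∫ U in G, φ U ∂μ ≤ M₀ := hint
  have hexp : 0 < Real.exp (ε * P) := Real.exp_pos _
  calc μ.real (B ∩ G) = (Real.exp (ε * P) * μ.real (B ∩ G)) * Real.exp (-(ε * P)) := by
        rw [Real.exp_neg]; field_simp
    _ ≤ M₀ * Real.exp (-(ε * P)) :=
        mul_le_mul_of_nonneg_right (h1.trans (h2.trans h3)) (Real.exp_nonneg _)

/-! ## §4 The per-plaquette log-square tail from the local insertion bound (finest bad level, no recursion) -/

/-- **PER-PLAQUETTE TAIL FROM THE LOCAL INSERTION BOUND.**  For one family `F` and one coupling `0 < γ ≤ 1`, a profile with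
`ε b₀ ≥ 8`, `b₀² ≥ 32`, `p₀ ≥ 2`, and the local-insertion bound (the `gibbsK`-integral over the local small-history event `G(a,j)` of
`exp(ε·min(|Ū^{j}(∂a) − 1|/g_{K−j}, p(g_{K−j})))` is `≤ M₀` for all `K`, `1 ≤ j ≤ K`, `a`): every block-averaged plaquette has Gibbs tail
`Gibbs_K{θ(K−j) ≤ |Ū^{j}(∂a) − 1|} ≤ C·β_{K−j}⁵·e^{−8(1 + log g_{K−j}⁻¹)²}` with `C = M₀(1 + 9·129³) + 9·129³·C_bare`.  Finest bad level:
`{large at (a,j)} ⊆ (G(a,j) ∩ large) ∪ G(a,j)ᶜ` and `G(a,j)ᶜ ⊆ ⋃_{i<j} ⋃_{q near a} (large at (q,i) ∩ G(q,i))`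
(`compl_localGood_subset`); Chernoff on each `G(q,i)` (`i ≥ 1`), the bare per-plaquette bound at `i = 0` (`gibbsMeasure_real_dist1_ge_le`),
the local count `≤ 9·129³·L^{3(j−i)}` (`card_near_le_real`) against the increments `p(g_{K−i}) − p(g_{K−j}) ≥ b₀(j−i) log L/2`.
[cite: Balaban1985UV3, (7) p.257 and (71) p.273] -/
theorem perPlaquette_of_localInsertion (F : T3Family) {γ b₀ p₀ ε M₀ : ℝ} (hγ : 0 < γ) (hγ1 : γ ≤ 1) (hε : 0 < ε)
    (hM₀ : 0 ≤ M₀) (hb₀ : 0 < b₀) (hεb : 8 ≤ ε * b₀) (hb32 : 32 ≤ b₀ ^ 2) (hp₀ : 2 ≤ p₀)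
    (hrun : ∀ (K j : ℕ), 1 ≤ j → j ≤ K → ∀ (a : Plaq (F.P K) j),
      ∫ U in {U | ∀ (i : ℕ) (q : Plaq (F.P K) i), i < j →
          Site.tdist (fun k => ((((q.src k).val * F.L ^ i : ℕ)) : ZMod ((F.P K).sitesPerDir 0)))
              (fun k => ((((a.src k).val * F.L ^ j : ℕ)) : ZMod ((F.P K).sitesPerDir 0))) + 64 * F.L ^ i ≤ 64 * F.L ^ j →
          GaugeGroup.dist1 (GaugeField.plaqHol
            (Averaging.iter (fun i' => BlockAveraging.blockAvg (P := F.P K) (j := i') ℰp) i U) q) <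
            θBal F.L γ b₀ p₀ (K - i)},
        Real.exp (ε * min (GaugeGroup.dist1 (GaugeField.plaqHol
            (Averaging.iter (fun i' => BlockAveraging.blockAvg (P := F.P K) (j := i') ℰp) j U) a) /
              Real.sqrt (γ * ((F.L : ℝ)⁻¹) ^ (K - j)))
          (B10.pFun b₀ p₀ (Real.sqrt (γ * ((F.L : ℝ)⁻¹) ^ (K - j))))) ∂(gibbsK F ℰp γ K) ≤ M₀) :
    ∃ C : ℝ, 0 ≤ C ∧ ∀ (K j : ℕ), 1 ≤ j → j ≤ K → ∀ p : Plaq (F.P K) j,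
      (gibbsK F ℰp γ K).real {U | θBal F.L γ b₀ p₀ (K - j) ≤
          GaugeGroup.dist1 (GaugeField.plaqHol
            (Averaging.iter (fun i => BlockAveraging.blockAvg (P := F.P K) (j := i) ℰp) j U) p)} ≤
        C * (F.scheme ℰp γ).β (K - j) ^ 5 *
          Real.exp (-(8 * (1 + Real.log (Real.sqrt (γ * ((F.L : ℝ)⁻¹) ^ (K - j)))⁻¹) ^ 2)) := by
  classical
  -- the bare per-plaquette bound (reflection positivity + chessboard + small balls, tree §1 of `T3FinestHeightTail`)
  obtain ⟨cH, hcH, -, hbare⟩ := gibbsMeasure_real_dist1_ge_le (N := 2)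
  set Cb : ℝ := 2 * Real.exp 24 * (cH ^ 3)⁻¹ with hCb
  have hCb0 : 0 ≤ Cb := by positivity
  set N₀ : ℝ := 9 * 129 ^ 3 with hN₀
  have hN₀0 : 0 ≤ N₀ := by norm_num [hN₀]
  refine ⟨M₀ * (1 + N₀) + N₀ * Cb, by positivity, fun K j hj1 hjK a => ?_⟩
  haveI := isProbabilityMeasure_gibbsK F ℰp hγ.le K
  have hL2 : 2 ≤ F.L := F.hL.2
  have hL1 : 1 ≤ F.L := by omega
  have hL0 : (0 : ℝ) < F.L := by exact_mod_cast (show 0 < F.L by omega)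
  have hβge : ∀ h : ℕ, 1 ≤ (F.scheme ℰp γ).β h := fun h => by
    show 1 ≤ (γ * ((F.L : ℝ)⁻¹) ^ h)⁻¹
    have hx0 : 0 < γ * ((F.L : ℝ)⁻¹) ^ h := mul_pos hγ (pow_pos (inv_pos.2 hL0) _)
    rw [one_le_inv₀ hx0]
    calc γ * ((F.L : ℝ)⁻¹) ^ h ≤ 1 * 1 := mul_le_mul hγ1 (pow_le_one₀ (inv_nonneg.2 hL0.le)
          (inv_le_one_of_one_le₀ (by exact_mod_cast hL1))) (by positivity) zero_le_one
      _ = 1 := one_mul _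
  -- observables, thresholds, tails, local good sets, local counts
  set μ := gibbsK F ℰp γ K with hμ
  set f : (i : ℕ) → Plaq (F.P K) i → GaugeField (F.P K) 0 (Matrix.specialUnitaryGroup (Fin 2) ℂ) → ℝ :=
    fun i q U => GaugeGroup.dist1 (GaugeField.plaqHol
      (Averaging.iter (fun i' => BlockAveraging.blockAvg (P := F.P K) (j := i') ℰp) i U) q) with hf
  set θ : ℕ → ℝ := fun i => θBal F.L γ b₀ p₀ (K - i) with hθ
  set e : ℕ → ℝ := fun i => Real.exp (-(ε * B10.pFun b₀ p₀ (Real.sqrt (γ * ((F.L : ℝ)⁻¹) ^ (K - i))))) with he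
  set E : ℝ := Real.exp (-(8 * (1 + Real.log (Real.sqrt (γ * ((F.L : ℝ)⁻¹) ^ (K - j)))⁻¹) ^ 2)) with hE
  set βj : ℝ := (F.scheme ℰp γ).β (K - j) with hβj
  set G : (i : ℕ) → Plaq (F.P K) i → Set (GaugeField (F.P K) 0 (Matrix.specialUnitaryGroup (Fin 2) ℂ)) := fun i q =>
    {U | ∀ (i' : ℕ) (q' : Plaq (F.P K) i'), i' < i →
        Site.tdist (fun k => ((((q'.src k).val * F.L ^ i' : ℕ)) : ZMod ((F.P K).sitesPerDir 0)))
            (fun k => ((((q.src k).val * F.L ^ i : ℕ)) : ZMod ((F.P K).sitesPerDir 0))) + 64 * F.L ^ i' ≤ 64 * F.L ^ i →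
        f i' q' U < θ i'} with hG
  set NEAR : (i : ℕ) → Finset (Plaq (F.P K) i) := fun i => Finset.univ.filter fun q : Plaq (F.P K) i =>
    Site.tdist (fun k => ((((q.src k).val * F.L ^ i : ℕ)) : ZMod ((F.P K).sitesPerDir 0)))
        (fun k => ((((a.src k).val * F.L ^ j : ℕ)) : ZMod ((F.P K).sitesPerDir 0))) + 64 * F.L ^ i ≤ 64 * F.L ^ j with hNEAR
  have hGm : ∀ i (q : Plaq (F.P K) i), MeasurableSet (G i q) := fun i q => measurableSet_localGood F θ K i _
  have hβj1 : 1 ≤ βj := (hβge (K - j))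
  have hE0 : 0 ≤ E := Real.exp_nonneg _
  -- (A) Chernoff on every local good set of height ≥ 1
  have hA : ∀ (i : ℕ) (q : Plaq (F.P K) i), 1 ≤ i → i ≤ K → μ.real ({U | θ i ≤ f i q U} ∩ G i q) ≤ M₀ * e i := by
    intro i q hi1 hiK
    exact chernoff_local F hγ hε q (hGm i q) (hrun K i hi1 hiK q)
  -- (B) the bare per-plaquette bound at height 0
  obtain ⟨hgK, hgK1, -, -⟩ :=
    Summit.QuantumFields.YangMills.Theorems.PoincareLipschitz.TwoSidedOfConcentration.coupling_basic hL1 hγ hγ1 K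
  obtain ⟨hgj, hgj1, -, -⟩ :=
    Summit.QuantumFields.YangMills.Theorems.PoincareLipschitz.TwoSidedOfConcentration.coupling_basic hL1 hγ hγ1 (K - j)
  have hB : ∀ q : Plaq (F.P K) 0, μ.real {U | θ 0 ≤ f 0 q U} ≤
      Cb * Real.sqrt ((F.scheme ℰp γ).β K) ^ 9 * Real.exp (-(B10.pFun b₀ p₀ (Real.sqrt (γ * ((F.L : ℝ)⁻¹) ^ K)) ^ 2 / 4)) := by
    intro q
    have hβ1 : 1 ≤ (F.scheme ℰp γ).β K := (hβge K)
    have hpf : 0 ≤ B10.pFun b₀ p₀ (Real.sqrt (γ * ((F.L : ℝ)⁻¹) ^ K)) :=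
      le_trans (by positivity) (sq_le_pFun hb₀.le hp₀ hgK hgK1)
    have hθ0 : 0 ≤ θBal F.L γ b₀ p₀ K := mul_nonneg (Real.sqrt_nonneg _) hpf
    have hp1 := hbare (F.P K) ((F.scheme ℰp γ).β K) hβ1 (θBal F.L γ b₀ p₀ K) hθ0 q
    have hcard2 : Fintype.card {q : Fin (F.P K).d × Fin (F.P K).d // q.1 < q.2} = 3 := by
      rw [show (F.P K).d = 3 from rfl]; decide
    have hd3 : (F.P K).d = 3 := rfl
    rw [hcard2, hd3] at hp1
    have hexp : (F.scheme ℰp γ).β K * θBal F.L γ b₀ p₀ K ^ 2 / (2 * (2 : ℕ)) =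
        B10.pFun b₀ p₀ (Real.sqrt (γ * ((F.L : ℝ)⁻¹) ^ K)) ^ 2 / 4 := by
      rw [beta_mul_θBal_sq F hγ]; norm_num
    rw [hexp] at hp1
    have hset : {U | θ 0 ≤ f 0 q U} =
        {U : GaugeField (F.P K) 0 (Matrix.specialUnitaryGroup (Fin 2) ℂ) |
          θBal F.L γ b₀ p₀ K ≤ GaugeGroup.dist1 (GaugeField.plaqHol U q)} := rfl
    rw [hset, hμ, gibbsK_eq]
    refine hp1.trans (le_of_eq ?_)
    rw [hCb]; norm_num
  -- (C) the covering by the finest bad level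
  have hcov : μ.real {U | θ j ≤ f j a U} ≤ μ.real ({U | θ j ≤ f j a U} ∩ G j a) + μ.real (G j a)ᶜ := by
    calc μ.real {U | θ j ≤ f j a U} ≤ μ.real (({U | θ j ≤ f j a U} ∩ G j a) ∪ (G j a)ᶜ) := by
          refine measureReal_mono (fun U hU => ?_)
          by_cases hUG : U ∈ G j a
          · exact Or.inl ⟨hU, hUG⟩
          · exact Or.inr hUG
      _ ≤ μ.real ({U | θ j ≤ f j a U} ∩ G j a) + μ.real (G j a)ᶜ := measureReal_union_le _ _
  have hcompl : μ.real (G j a)ᶜ ≤ ∑ i ∈ Finset.range j, ∑ q ∈ NEAR i, μ.real ({U | θ i ≤ f i q U} ∩ G i q) := by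
    have hsub := compl_localGood_subset F K j a f θ
    calc μ.real (G j a)ᶜ
        ≤ μ.real (⋃ i ∈ Finset.range j, ⋃ q ∈ NEAR i, ({U | θ i ≤ f i q U} ∩ G i q)) :=
          measureReal_mono hsub (measure_ne_top μ _)
      _ ≤ ∑ i ∈ Finset.range j, μ.real (⋃ q ∈ NEAR i, ({U | θ i ≤ f i q U} ∩ G i q)) :=
          measureReal_biUnion_finset_le _ _
      _ ≤ ∑ i ∈ Finset.range j, ∑ q ∈ NEAR i, μ.real ({U | θ i ≤ f i q U} ∩ G i q) :=
          Finset.sum_le_sum fun i _ => measureReal_biUnion_finset_le _ _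
  -- (D) the local counts
  have hcardNEAR : ∀ i, i ≤ j → ((NEAR i).card : ℝ) ≤ N₀ * ((F.L : ℝ) ^ (j - i)) ^ 3 := fun i hij => by
    rw [hN₀]; exact card_near_le_real F hij hjK a
  -- height 0: the bare block
  have hS0 : ∑ q ∈ NEAR 0, μ.real ({U | θ 0 ≤ f 0 q U} ∩ G 0 q) ≤ N₀ * Cb * (βj ^ 5 * E) := by
    have hterm : ∀ q ∈ NEAR 0, μ.real ({U | θ 0 ≤ f 0 q U} ∩ G 0 q) ≤
        Cb * Real.sqrt ((F.scheme ℰp γ).β K) ^ 9 * Real.exp (-(B10.pFun b₀ p₀ (Real.sqrt (γ * ((F.L : ℝ)⁻¹) ^ K)) ^ 2 / 4)) :=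
      fun q _ => (measureReal_mono Set.inter_subset_left).trans (hB q)
    refine (Finset.sum_le_sum hterm).trans ?_
    rw [Finset.sum_const, nsmul_eq_mul]
    have hc := hcardNEAR 0 (Nat.zero_le j)
    rw [Nat.sub_zero] at hc
    have hbl := bare_level_le F hγ hγ1 hb₀.le hb32 hp₀ hjK
    have hnn : 0 ≤ Real.sqrt ((F.scheme ℰp γ).β K) ^ 9 * Real.exp (-(B10.pFun b₀ p₀ (Real.sqrt (γ * ((F.L : ℝ)⁻¹) ^ K)) ^ 2 / 4)) :=
      by positivity
    calc ((NEAR 0).card : ℝ) * (Cb * Real.sqrt ((F.scheme ℰp γ).β K) ^ 9 *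
          Real.exp (-(B10.pFun b₀ p₀ (Real.sqrt (γ * ((F.L : ℝ)⁻¹) ^ K)) ^ 2 / 4)))
        ≤ (N₀ * ((F.L : ℝ) ^ j) ^ 3) * (Cb * Real.sqrt ((F.scheme ℰp γ).β K) ^ 9 *
          Real.exp (-(B10.pFun b₀ p₀ (Real.sqrt (γ * ((F.L : ℝ)⁻¹) ^ K)) ^ 2 / 4))) :=
          mul_le_mul_of_nonneg_right hc (by positivity)
      _ = N₀ * Cb * (((F.L : ℝ) ^ j) ^ 3 * Real.sqrt ((F.scheme ℰp γ).β K) ^ 9 *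
          Real.exp (-(B10.pFun b₀ p₀ (Real.sqrt (γ * ((F.L : ℝ)⁻¹) ^ K)) ^ 2 / 4))) := by ring
      _ ≤ N₀ * Cb * (βj ^ 5 * E) := mul_le_mul_of_nonneg_left hbl (by positivity)
  -- heights 1 ≤ i < j: Chernoff + the deeper levels pay for their volume
  have hSi : ∀ i ∈ Finset.Ico 1 j, ∑ q ∈ NEAR i, μ.real ({U | θ i ≤ f i q U} ∩ G i q) ≤
      N₀ * M₀ * (e j * ((F.L : ℝ)⁻¹) ^ (j - i)) := by
    intro i hi
    rw [Finset.mem_Ico] at hi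
    have hij : i ≤ j := hi.2.le
    have hterm : ∀ q ∈ NEAR i, μ.real ({U | θ i ≤ f i q U} ∩ G i q) ≤ M₀ * e i :=
      fun q _ => hA i q hi.1 (hij.trans hjK)
    refine (Finset.sum_le_sum hterm).trans ?_
    rw [Finset.sum_const, nsmul_eq_mul]
    have hc := hcardNEAR i hij
    have hp₀1 : (1 : ℝ) ≤ p₀ := by linarith
    have hdeep := exp_pFun_deeper_le F hγ hγ1 hb₀.le hp₀1 hε.le hεb hij hjK
    have he0 : 0 ≤ e i := Real.exp_nonneg _
    calc ((NEAR i).card : ℝ) * (M₀ * e i) ≤ (N₀ * ((F.L : ℝ) ^ (j - i)) ^ 3) * (M₀ * e i) :=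
          mul_le_mul_of_nonneg_right hc (by positivity)
      _ = N₀ * M₀ * (e i * ((F.L : ℝ) ^ (j - i)) ^ 3) := by ring
      _ ≤ N₀ * M₀ * (e j * ((F.L : ℝ)⁻¹) ^ (j - i)) := mul_le_mul_of_nonneg_left hdeep (by positivity)
  have hgeo : ∑ i ∈ Finset.Ico 1 j, ((F.L : ℝ)⁻¹) ^ (j - i) ≤ 1 := sum_Ico_inv_pow_le_one hL2 (le_refl j)
  have hSum : ∑ i ∈ Finset.range j, ∑ q ∈ NEAR i, μ.real ({U | θ i ≤ f i q U} ∩ G i q) ≤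
      N₀ * Cb * (βj ^ 5 * E) + N₀ * M₀ * e j := by
    rw [Finset.range_eq_Ico, Finset.sum_eq_sum_Ico_succ_bot hj1]
    refine add_le_add hS0 ?_
    calc ∑ i ∈ Finset.Ico (0 + 1) j, ∑ q ∈ NEAR i, μ.real ({U | θ i ≤ f i q U} ∩ G i q)
        ≤ ∑ i ∈ Finset.Ico 1 j, N₀ * M₀ * (e j * ((F.L : ℝ)⁻¹) ^ (j - i)) := Finset.sum_le_sum hSi
      _ = N₀ * M₀ * e j * ∑ i ∈ Finset.Ico 1 j, ((F.L : ℝ)⁻¹) ^ (j - i) := by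
          rw [Finset.mul_sum]; exact Finset.sum_congr rfl fun i _ => by ring
      _ ≤ N₀ * M₀ * e j * 1 := mul_le_mul_of_nonneg_left hgeo (by positivity)
      _ = N₀ * M₀ * e j := mul_one _
  -- (E) collect: `e j ≤ E`, `1 ≤ βj`
  have hej : e j ≤ E := exp_pFun_le_logSq hgj hgj1 hb₀.le hp₀ hε.le hεb
  have hT1 : μ.real ({U | θ j ≤ f j a U} ∩ G j a) ≤ M₀ * e j := hA j a hj1 hjK
  have hβ5 : 1 ≤ βj ^ 5 := one_le_pow₀ hβj1
  have hfin : M₀ * e j + (N₀ * Cb * (βj ^ 5 * E) + N₀ * M₀ * e j) ≤ (M₀ * (1 + N₀) + N₀ * Cb) * βj ^ 5 * E := by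
    have h1 : M₀ * e j ≤ M₀ * (βj ^ 5 * E) := by
      refine mul_le_mul_of_nonneg_left (hej.trans ?_) hM₀
      exact le_mul_of_one_le_left hE0 hβ5
    have h2 : N₀ * M₀ * e j ≤ N₀ * M₀ * (βj ^ 5 * E) := by
      refine mul_le_mul_of_nonneg_left (hej.trans ?_) (by positivity)
      exact le_mul_of_one_le_left hE0 hβ5
    nlinarith
  calc μ.real {U | θ j ≤ f j a U} ≤ μ.real ({U | θ j ≤ f j a U} ∩ G j a) + μ.real (G j a)ᶜ := hcov
    _ ≤ M₀ * e j + (N₀ * Cb * (βj ^ 5 * E) + N₀ * M₀ * e j) := add_le_add hT1 (hcompl.trans hSum)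
    _ ≤ (M₀ * (1 + N₀) + N₀ * Cb) * βj ^ 5 * E := hfin

end Summit.QuantumFields.YangMills.Theorems.LocalInsertion.HistoryTailOfInsertion

end
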